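import Literature.NumberTheory.EllipticCurves.TwoDescentGaloisNormProofs
import Summits.BirchSwinnertonDyer.BirchSwinnertonDyer.Theorems.PrintCf2RamifiedOffTYZVisibleGenerator
import Literature.NumberTheory.EllipticCurves.TianYuanZhang2017.CMPointGaloisDisplays
import HarnessLib

/-!
# Route `PrintCf2`, crux stmt-BirchSwinnertonDyer-20509 `RamifiedOffTYZOfFacts` — THE GALOIS-NORM CHORD IDENTITY ON TYZ's CURVE `A` OVER `ℍ′_n`:
# the `2`-descent classes of a trace `z + z^g` (`g ∈ Aut_ℚ(ℍ′_n)`, `g²` fixing `z`) are the `g`-NORMS of those of `z`, modulo squares of `g`-FIXED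
# elements (cell `bsd-print-cf2`, LEAD of 20509 g24, line `offtyz-v7`, lineage cycle 25; Theses-free, no `def`, no named fact)

HONEST FRAMING.  Bookkeeping on the objects of Tian–Yuan–Zhang 2017 §3 (the number field `ℍ′_n = D.H` of `D : GenusPointData n`, the curve
`A : Y² = X³ + 4X` = `curveA`, the action `D.galPt g` of `g ∈ Aut_ℚ(ℍ′_n)` on `A(ℍ′_n)`); nothing about BSD is asserted; C⁺ =
`stub_offTYZ_levelTwoScriptLExact` = item stmt-BirchSwinnertonDyer-23431 stays OPEN.  `--supports stmt-BirchSwinnertonDyer-20509` (helper).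

WHY.  On the silent stratum of the jump-one class and for the upper half of C⁺ everywhere, the open statement is a `2`-divisibility bit of TYZ's genus
period `Z(n)` / genus point `P(n)` in `A(ℍ′_n)` modulo torsion (memos `Lines/offtyz_v7_GenusPeriodBit.md`, `…RigidityAndUnits.md` §4), i.e. the
triviality of its `2`-descent (Kummer) classes `([X − 2i], [X], [X + 2i])` over `ℍ′_n`.  `Z(n)` is a TRACE of CM points (`Z(d) = Σ_{t∈Φ₀} z_d^t`,
display (G1); for `d ≡ 7` a trace over `2Cl_d`), so its classes should be NORMS of the classes of `X(z) − e` — square classes of norms of CM values of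
the level-32 modular units `x, x ∓ 2i` (g19's LAW (K1), the U-road).  The Literature brick `TwoDescentGaloisNormProofs` (p782639) proves the quadratic
step of exactly this for any Weierstrass curve; this file instantiates it on `A/ℍ′_n` with TYZ's `galPt`:

* §1 `galPt_some` — `(X, Y)^g = (gX, gY)`; the coefficients of `A` and the torsion abscissae `0, ±2i` are fixed by every `g` with `g(i) = i`
  (`0` by every `g`).
* §2 ★ `trace_sq_witness_two_im` / `trace_sq_witness_zero` / `trace_sq_witness_neg_two_im` — for `z = (X, Y) ∈ A(ℍ′_n)` and `g ∈ Aut_ℚ(ℍ′_n)`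
  with `g²` fixing `z` and `X^g ≠ X` (and `g(i) = i` for the abscissae `±2i`): the abscissa `X₃` of `z + z^g` is `g`-fixed and
  `(X − e)(X^g − e)(X₃ − e) = t²` with `t` FIXED by `g`, for `e = 2i, 0, −2i` — so over the fixed field of `g` the descent class of the trace
  `z + z^g` at `e` is the class of the `g`-NORM of `X − e`; ★ `trace_point_eq` — `z + z^g = (X₃, Y₃)` with `Y₃` also `g`-fixed.
* §3 `trace_norm_eq_of_addX_eq_*` — the degenerate case `z + z^g = T_e`: the norm is the descent value at `T_e` exactly.

Iterating §2 along a chain `g₁, g₂, …` with `gⱼ²` trivial on the previous partial trace (the cyclic `2`-part of `2Cl_d`, then the odd part by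
injectivity of square classes in odd degree) reads the Kummer classes of `Z(d)` over the genus field as norms from the ring class field — the form in
which (U1)–(U3) (modular units, Shimura reciprocity, genus Kronecker limit formula) would evaluate them.  Beyond-print theorem: no (kernel plumbing).
BSD is not proved by any of this; no class is closed by this file.

References: [cite: TianYuanZhang2017, §3.1 (p0011 L53–L66: Z(n) as a trace, ℍ′_n, A(ℍ′_n) a ℤ[i]-module), Lemma 3.16 (p0017 L98–L113: A[2] = {O,(0,0),(±2i,0)})];
[cite: SilvermanAEC2009, Prop. X.1.4, Thm. X.1.1]; [cite: NeukirchSchmidtWingberg2008, §1.5]; tree `Literature/…/TwoDescentGaloisNormProofs` (p782639),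
`…VisibleGenerator` (`splitTwoTorsion_curveA`), `TianYuanZhang2017/CMPointGaloisDisplays` (`galPt`).
-/

noncomputable section

open scoped Classical

open WeierstrassCurve WeierstrassCurve.Affine WeierstrassCurve.Affine.Point
  Literature.NumberTheory.EllipticCurves Literature.NumberTheory.EllipticCurves.TianYuanZhang2017
  Summit.BirchSwinnertonDyer.PrintCf2.VisibleGenerator

set_option autoImplicit false

namespace Summit.BirchSwinnertonDyer.PrintCf2.GaloisNorm

variable {n : ℕ}

/-! ## §1 The action on coordinates; the coefficients of `A` and the torsion abscissae are fixed -/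

/-- The coefficients `a₁ = a₂ = a₃ = a₆ = 0`, `a₄ = 4` of `A/ℍ′_n` are fixed by every `g ∈ Aut_ℚ(ℍ′_n)`. [cite: TianYuanZhang2017, §3.1 (p0010 L11: A : 2y² = x³ + x ≅ Y² = X³ + 4X)] -/
theorem coeff_fixed (D : GenusPointData n) (g : D.H ≃ₐ[ℚ] D.H) :
    (g : D.H →+* D.H) (curveA.baseChange D.H).toAffine.a₁ = (curveA.baseChange D.H).toAffine.a₁ ∧
    (g : D.H →+* D.H) (curveA.baseChange D.H).toAffine.a₂ = (curveA.baseChange D.H).toAffine.a₂ ∧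
    (g : D.H →+* D.H) (curveA.baseChange D.H).toAffine.a₃ = (curveA.baseChange D.H).toAffine.a₃ ∧
    (g : D.H →+* D.H) (curveA.baseChange D.H).toAffine.a₄ = (curveA.baseChange D.H).toAffine.a₄ ∧
    (g : D.H →+* D.H) (curveA.baseChange D.H).toAffine.a₆ = (curveA.baseChange D.H).toAffine.a₆ := by
  refine ⟨?_, ?_, ?_, ?_, ?_⟩ <;> simp [curveA, WeierstrassCurve.baseChange, map_ofNat]

/-- `(X, Y)^g = (gX, gY)` for `g ∈ Aut_ℚ(ℍ′_n)` (TYZ's `R ↦ R^g` on `A(ℍ′_n)`, tree `galPt = Point.map`).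
[cite: TianYuanZhang2017, §3.1 (p0011 L53–L58)] -/
theorem galPt_some (D : GenusPointData n) (g : D.H ≃ₐ[ℚ] D.H) {x y : D.H} (h : (curveA.baseChange D.H).toAffine.Nonsingular x y) :
    D.galPt g (.some x y h) =
      .some (g x) (g y) (nonsingular_apply_of_fixed (W := (curveA.baseChange D.H).toAffine) (g : D.H →+* D.H)
        (coeff_fixed D g).1 (coeff_fixed D g).2.1 (coeff_fixed D g).2.2.1 (coeff_fixed D g).2.2.2.1 (coeff_fixed D g).2.2.2.2 h) := by
  rw [GenusPointData.galPt, Point.map_some]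
  congr 1

/-- `g(±2i) = ±2i` when `g(i) = i`. [cite: TianYuanZhang2017, Lemma 3.16 (p0017 L98–L101: A(ℚ(i)) = A[(1+i)³])] -/
theorem two_im_fixed (D : GenusPointData n) (g : D.H ≃ₐ[ℚ] D.H) (hgi : g D.im = D.im) :
    (g : D.H →+* D.H) (2 * D.im) = 2 * D.im ∧ (g : D.H →+* D.H) (-(2 * D.im)) = -(2 * D.im) := by
  have h2 : (g : D.H →+* D.H) (2 * D.im) = 2 * D.im := by
    rw [map_mul, map_ofNat]
    exact congrArg (2 * ·) hgi
  exact ⟨h2, by rw [map_neg, h2]⟩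

/-! ## §2 The trace `z + z^g`: its coordinates and chord witness are `g`-fixed; the descent classes are norms modulo fixed squares -/

/-- **`z + z^g = (X₃, Y₃)` with BOTH coordinates fixed by `g`** (`z = (X, Y) ∈ A(ℍ′_n)`, `g²` fixing `z`, `X^g ≠ X`); `X₃, Y₃` are Mathlib's
`addX`, `addY` of the chord through `z` and `z^g`. [cite: TianYuanZhang2017, §3.1 (p0011 L53–L66)] [cite: SilvermanAEC2009, III.2.3] -/
theorem trace_point_eq (D : GenusPointData n) (g : D.H ≃ₐ[ℚ] D.H) {x y : D.H} (h : (curveA.baseChange D.H).toAffine.Nonsingular x y)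
    (hgx : g (g x) = x) (hgy : g (g y) = y) (hx : g x ≠ x) :
    let W := (curveA.baseChange D.H).toAffine
    ∃ h₃ : W.Nonsingular (W.addX x (g x) (W.slope x (g x) y (g y))) (W.addY x (g x) y (W.slope x (g x) y (g y))),
      (Point.some x y h : APoint D.H) + D.galPt g (.some x y h) =
        .some (W.addX x (g x) (W.slope x (g x) y (g y))) (W.addY x (g x) y (W.slope x (g x) y (g y))) h₃ ∧
      g (W.addX x (g x) (W.slope x (g x) y (g y))) = W.addX x (g x) (W.slope x (g x) y (g y)) ∧
      g (W.addY x (g x) y (W.slope x (g x) y (g y))) = W.addY x (g x) y (W.slope x (g x) y (g y)) := by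
  intro W
  obtain ⟨ha₁, ha₂, ha₃, ha₄, ha₆⟩ := coeff_fixed D g
  have hx' : x ≠ g x := Ne.symm hx
  have h₂ : W.Nonsingular (g x) (g y) := nonsingular_apply_of_fixed (g : D.H →+* D.H) ha₁ ha₂ ha₃ ha₄ ha₆ h
  refine ⟨nonsingular_add h h₂ fun hc => hx' hc.1, ?_, ?_, ?_⟩
  · rw [galPt_some, Point.add_of_X_ne hx']
  · exact addX_fixed (g : D.H →+* D.H) ha₁ ha₂ hgx hgy hx
  · exact addY_fixed (g : D.H →+* D.H) ha₁ ha₂ ha₃ hgx hgy hx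

/-- **Descent class of the trace at `T = (2i, 0)` is the `g`-norm, modulo `g`-FIXED squares** (`g(i) = i`, `g²` fixing `z = (X, Y)`, `X^g ≠ X`):
the abscissa `X₃` of `z + z^g` and the norm `(X − 2i)(X^g − 2i)` are fixed by `g`, and `(X − 2i)(X^g − 2i)(X₃ − 2i) = t²` with `g t = t`.
[cite: TianYuanZhang2017, §3.1 (p0011 L53–L66), Lemma 3.16] [cite: SilvermanAEC2009, Prop. X.1.4, Thm. X.1.1] [cite: NeukirchSchmidtWingberg2008, §1.5] -/
theorem trace_sq_witness_two_im (D : GenusPointData n) (g : D.H ≃ₐ[ℚ] D.H) (hgi : g D.im = D.im) {x y : D.H}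
    (h : (curveA.baseChange D.H).toAffine.Nonsingular x y) (hgx : g (g x) = x) (hgy : g (g y) = y) (hx : g x ≠ x) :
    let W := (curveA.baseChange D.H).toAffine
    g (W.addX x (g x) (W.slope x (g x) y (g y))) = W.addX x (g x) (W.slope x (g x) y (g y)) ∧
    g ((x - 2 * D.im) * (g x - 2 * D.im)) = (x - 2 * D.im) * (g x - 2 * D.im) ∧
    ∃ t : D.H, g t = t ∧
      (x - 2 * D.im) * (g x - 2 * D.im) * (W.addX x (g x) (W.slope x (g x) y (g y)) - 2 * D.im) = t ^ 2 := by
  intro W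
  obtain ⟨ha₁, ha₂, ha₃, ha₄, ha₆⟩ := coeff_fixed D g
  exact exists_fixed_sq_witness (g : D.H →+* D.H) (splitTwoTorsion_curveA D) ha₁ ha₂ ha₃ ha₄ ha₆ (two_im_fixed D g hgi).1 h hgx hgy hx

/-- **Descent class of the trace at `T = (0, 0) = τ(1)` is the `g`-norm, modulo `g`-FIXED squares** (ANY `g ∈ Aut_ℚ(ℍ′_n)` with `g²` fixing `z`,
`X^g ≠ X`): `X·X^g·X₃ = t²` with `g t = t`, `X₃` and `X·X^g` fixed.
[cite: TianYuanZhang2017, §3.1 (p0011 L53–L66), Lemma 3.16] [cite: SilvermanAEC2009, Prop. X.1.4, Thm. X.1.1] [cite: NeukirchSchmidtWingberg2008, §1.5] -/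
theorem trace_sq_witness_zero (D : GenusPointData n) (g : D.H ≃ₐ[ℚ] D.H) {x y : D.H}
    (h : (curveA.baseChange D.H).toAffine.Nonsingular x y) (hgx : g (g x) = x) (hgy : g (g y) = y) (hx : g x ≠ x) :
    let W := (curveA.baseChange D.H).toAffine
    g (W.addX x (g x) (W.slope x (g x) y (g y))) = W.addX x (g x) (W.slope x (g x) y (g y)) ∧
    g ((x - 0) * (g x - 0)) = (x - 0) * (g x - 0) ∧
    ∃ t : D.H, g t = t ∧ (x - 0) * (g x - 0) * (W.addX x (g x) (W.slope x (g x) y (g y)) - 0) = t ^ 2 := by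
  intro W
  obtain ⟨ha₁, ha₂, ha₃, ha₄, ha₆⟩ := coeff_fixed D g
  exact exists_fixed_sq_witness (g : D.H →+* D.H) (splitTwoTorsion_curveA D).swap₁₂ ha₁ ha₂ ha₃ ha₄ ha₆ (map_zero _) h hgx hgy hx

/-- **Descent class of the trace at `T = (−2i, 0)` is the `g`-norm, modulo `g`-FIXED squares** (`g(i) = i`).
[cite: TianYuanZhang2017, §3.1 (p0011 L53–L66), Lemma 3.16] [cite: SilvermanAEC2009, Prop. X.1.4, Thm. X.1.1] [cite: NeukirchSchmidtWingberg2008, §1.5] -/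
theorem trace_sq_witness_neg_two_im (D : GenusPointData n) (g : D.H ≃ₐ[ℚ] D.H) (hgi : g D.im = D.im) {x y : D.H}
    (h : (curveA.baseChange D.H).toAffine.Nonsingular x y) (hgx : g (g x) = x) (hgy : g (g y) = y) (hx : g x ≠ x) :
    let W := (curveA.baseChange D.H).toAffine
    g (W.addX x (g x) (W.slope x (g x) y (g y))) = W.addX x (g x) (W.slope x (g x) y (g y)) ∧
    g ((x - -(2 * D.im)) * (g x - -(2 * D.im))) = (x - -(2 * D.im)) * (g x - -(2 * D.im)) ∧
    ∃ t : D.H, g t = t ∧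
      (x - -(2 * D.im)) * (g x - -(2 * D.im)) * (W.addX x (g x) (W.slope x (g x) y (g y)) - -(2 * D.im)) = t ^ 2 := by
  intro W
  obtain ⟨ha₁, ha₂, ha₃, ha₄, ha₆⟩ := coeff_fixed D g
  exact exists_fixed_sq_witness (g : D.H →+* D.H) (splitTwoTorsion_curveA D).swap₂₃.swap₁₂ ha₁ ha₂ ha₃ ha₄ ha₆
    (two_im_fixed D g hgi).2 h hgx hgy hx

/-! ## §3 The degenerate cases `z + z^g ∈ A[2]`: the norm is the descent value at the torsion point, exactly -/

/-- If `z + z^g = (2i, 0)` then `(X − 2i)(X^g − 2i) = (2i − 0)(2i + 2i) = −8` exactly (`g(i) = i`).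
[cite: TianYuanZhang2017, Lemma 3.16] [cite: SilvermanAEC2009, Prop. X.1.4 (value at T₁)] -/
theorem trace_norm_eq_of_addX_eq_two_im (D : GenusPointData n) (g : D.H ≃ₐ[ℚ] D.H) (hgi : g D.im = D.im) {x y : D.H}
    (h : (curveA.baseChange D.H).toAffine.Nonsingular x y) (hx : g x ≠ x)
    (hT : (curveA.baseChange D.H).toAffine.addX x (g x) ((curveA.baseChange D.H).toAffine.slope x (g x) y (g y)) = 2 * D.im) :
    (x - 2 * D.im) * (g x - 2 * D.im) = (2 * D.im - 0) * (2 * D.im - -(2 * D.im)) := by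
  obtain ⟨ha₁, ha₂, ha₃, ha₄, ha₆⟩ := coeff_fixed D g
  exact norm_eq_of_addX_eq (g : D.H →+* D.H) (splitTwoTorsion_curveA D) ha₁ ha₂ ha₃ ha₄ ha₆ (two_im_fixed D g hgi).1 h hx hT

/-- If `z + z^g = (0, 0) = τ(1)` then `X·X^g = (0 − 2i)(0 + 2i) = 4` exactly (any `g`).
[cite: TianYuanZhang2017, Lemma 3.16] [cite: SilvermanAEC2009, Prop. X.1.4 (value at T₁)] -/
theorem trace_norm_eq_of_addX_eq_zero (D : GenusPointData n) (g : D.H ≃ₐ[ℚ] D.H) {x y : D.H}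
    (h : (curveA.baseChange D.H).toAffine.Nonsingular x y) (hx : g x ≠ x)
    (hT : (curveA.baseChange D.H).toAffine.addX x (g x) ((curveA.baseChange D.H).toAffine.slope x (g x) y (g y)) = 0) :
    (x - 0) * (g x - 0) = (0 - 2 * D.im) * (0 - -(2 * D.im)) := by
  obtain ⟨ha₁, ha₂, ha₃, ha₄, ha₆⟩ := coeff_fixed D g
  exact norm_eq_of_addX_eq (g : D.H →+* D.H) (splitTwoTorsion_curveA D).swap₁₂ ha₁ ha₂ ha₃ ha₄ ha₆ (map_zero _) h hx hT

end Summit.BirchSwinnertonDyer.PrintCf2.GaloisNorm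

end
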